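import Literature.NumberTheory.LFunctions.WeilWindowSuzukiProofs
import Summits.RiemannHypothesis.RiemannHypothesis.Theses.WeilGroundState
import HarnessLib

/-!
# Route WeilGroundState — support item `SmallWindowsSimpleEven` (stmt-RiemannHypothesis-1531)

The small-window clause of `GroundStateSimpleEven`: there is `a₀ > 0` such that for every window
`0 < a ≤ a₀` some witness `φ` and gap `δ > 0` push every `L²`-normalised test function on `[-a, a]`
that is odd, or even and `L²`-orthogonal to `φ`, at least `δ` above the ground energy
`ε(a) = weilGroundEnergy a`.

This is the (proved, in-tree) variational form of Suzuki 2026, Thm. 1.4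
(`Literature.NumberTheory.LFunctions.Suzuki2026_thm_1_4_holds`, file
`Literature/NumberTheory/LFunctions/WeilWindowSuzukiProofs.lean`: witness `φ = 1`, gap `δ = 1/10`,
`a₀ = min (1/100) a₁`; an odd test function and an even one orthogonal to `1` are both mean-zero, and
mean-zero normalised test functions on a window `a ≤ 1/100` sit `≥ 1/10` above `ε(a)` by the Markov
decomposition of `Re Q` and a bathtub bound), composed with the `Iff.rfl` corollary
`Suzuki2026_thm_1_4.smallWindowsSimpleEven` (`WeilWindowSuzuki.lean`), whose conclusion is the route
decl verbatim.
-/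

namespace Summit.RiemannHypothesis.RiemannHypothesis.Theorems

open Literature.NumberTheory.LFunctions

set_option linter.dupNamespace false in
/-- **Item `SmallWindowsSimpleEven` of route WeilGroundState, proved.** There is `a₀ > 0` such that
for all `0 < a ≤ a₀` the window-`a` clause of `GroundStateSimpleEven` holds (witness `φ = 1`,
`δ = 1/10`): a direct consequence of the in-tree discharge `Suzuki2026_thm_1_4_holds` of Suzuki 2026,
Thm. 1.4 (arXiv:2606.09096) in its variational rendering. -/
theorem smallWindowsSimpleEven_proof :
    Summit.RiemannHypothesis.RiemannHypothesis.Theses.WeilGroundState.SmallWindowsSimpleEven := by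
  unfold Summit.RiemannHypothesis.RiemannHypothesis.Theses.WeilGroundState.SmallWindowsSimpleEven
  exact Suzuki2026_thm_1_4_holds.smallWindowsSimpleEven

end Summit.RiemannHypothesis.RiemannHypothesis.Theorems
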